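import Summits.HubbardSuperconductivity.HubbardSuperconductivity.Theorems.AnisotropyChordTransferFibre3GresZeroLower
import Literature.NumberTheory.LFunctions.LagariasNumerical

/-!
# Route `AnisotropyChord` / H0 rotor rung: the LOGARITHMIC a-priori bound on the ground two-magnon eigenvalue, III — `2λ₂ < ε₁` ∀L and the exact `η_eff` identity

Consequences of `…Fibre3Lam2LogBound` / `…Fibre3GresZeroLower` (`λ₂ ≤ π²/(V·H_{(L−1)/2})`) for the GM₃ ∀L certificate
(rung stmt-HubbardSuperconductivity-19089, memo ROTOR-THEORY-21 §296–§302):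
* `eps1_eq_two_sin_sq`: `ε₁ = 2 sin²(π/L)`; `eps1_ge_eight_div`: `ε₁ ≥ 8/V` (Jordan); `eps1_ge_cubic`: `ε₁ ≥ 2(π/L)²(1 − π²/(6V))²`
  (`sin x > x − x³/6`);
* `harmonic_two`, `harmonic_half_ge`: `H_N ≥ H_2 = 3/2` for `N ≥ 2` (monotonicity from `Literature…LagariasNumerical.harmonic_mono`);
* ★★ `two_lam2_lt_eps1`: **`2λ₂ < ε₁` for the ground profile, every `L ≥ 5`, `0 ≤ Δ`** — discharges ∀L the smallness
  hypotheses `2·lam2 < eps1 L` of `TtailBounds` (PartN33 Layer C) and `lam2 < 2·eps1 L` of `GreenZeroIdentity` / the kernel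
  identities (`lam2_lt_two_eps1`), which the flat bound `λ₂(V−1) ≤ 4(1−Δ)` does NOT give for small `Δ` (`8/(V−1) > 8/V`);
* `Gres_zero_zero_eq_sum_erase`: `G̃_λ(0)` is the `Gzero` sum of `GreenZeroIdentity`; `Gres_zero_zero_mono`: `λ ↦ G̃_λ(0)` is
  non-decreasing on `[0, 2ε₁)`;
* ★★ `inv_etaEff_eq`: the EXACT identity **`1/η_eff = 4G̃_{λ₂}(0) + 4Δ/(4(1−Δ) + Δλ₂)`** (`L ≥ 5`, `0 ≤ Δ < 1`; the Green-zero
  identity made unconditional by `two_lam2_lt_eps1`), whence ★ `etaEff_le_sharp`: `η_eff ≤ 1/(4G̃₀(0) + 4Δ/(4(1−Δ) + Δλ₂))`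
  (the `Δ`-improved form of `etaEff_le_inv_Gres`).
Prover seat `hubbard-h0-rotor-p1` g24; helper for stmt-HubbardSuperconductivity-19089 (`--supports`).
-/

set_option linter.dupNamespace false
set_option autoImplicit false

noncomputable section

open scoped BigOperators
open Complex

namespace Summit.HubbardSuperconductivity.HubbardSuperconductivity.Theorems.AnisotropyChord.Transfer.Fibre3

variable (L : ℕ) [NeZero L]

/-! ## `ε₁` from below -/

omit [NeZero L] in
/-- `ε₁ = 2 sin²(π/L)`. [folklore] -/
theorem eps1_eq_two_sin_sq : eps1 L = 2 * Real.sin (Real.pi / L) ^ 2 := by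
  unfold eps1
  rw [show 2 * Real.pi / (L : ℝ) = 2 * (Real.pi / L) by ring]
  exact FreeGap.one_sub_cos_eq _

omit [NeZero L] in
/-- Jordan's inequality: `ε₁ ≥ 8/V` (`L ≥ 2`). [folklore] -/
theorem eps1_ge_eight_div (hL : 2 ≤ L) : 8 / (L : ℝ) ^ 2 ≤ eps1 L := by
  rw [eps1_eq_two_sin_sq]
  have hLpos : (0 : ℝ) < L := by exact_mod_cast (show 0 < L by omega)
  have hL2 : (2 : ℝ) ≤ L := by exact_mod_cast hL
  have hx0 : 0 ≤ Real.pi / L := by positivity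
  have hx1 : Real.pi / L ≤ Real.pi / 2 := div_le_div_of_nonneg_left Real.pi_pos.le (by norm_num) hL2
  have h := Real.mul_le_sin hx0 hx1
  have h2 : 2 / Real.pi * (Real.pi / L) = 2 / L := by field_simp
  rw [h2] at h
  have h3 : 0 ≤ 2 / (L : ℝ) := by positivity
  have h4 : (2 / (L : ℝ)) ^ 2 ≤ Real.sin (Real.pi / L) ^ 2 := pow_le_pow_left₀ h3 h 2
  calc 8 / (L : ℝ) ^ 2 = 2 * (2 / (L : ℝ)) ^ 2 := by field_simp; norm_num
    _ ≤ 2 * Real.sin (Real.pi / L) ^ 2 := by linarith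

omit [NeZero L] in
/-- the cubic Taylor bound: `ε₁ ≥ 2(π/L)²(1 − (π/L)²/6)²` (`L ≥ 2`, where `π/L ≤ π/2 < √6`). [folklore] -/
theorem eps1_ge_cubic (hL : 2 ≤ L) :
    2 * (Real.pi / L) ^ 2 * (1 - (Real.pi / L) ^ 2 / 6) ^ 2 ≤ eps1 L := by
  rw [eps1_eq_two_sin_sq]
  have hLpos : (0 : ℝ) < L := by exact_mod_cast (show 0 < L by omega)
  have hL2 : (2 : ℝ) ≤ L := by exact_mod_cast hL
  set x : ℝ := Real.pi / L with hx
  have hx0 : 0 < x := by positivity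
  have hxle : x ≤ Real.pi / 2 := div_le_div_of_nonneg_left Real.pi_pos.le (by norm_num) hL2
  have hpi := Real.pi_lt_d2
  have hx2 : x ^ 2 ≤ 6 := by nlinarith
  have hs := Real.sin_gt_sub_cube hx0
  have hnn : 0 ≤ x - x ^ 3 / 6 := by nlinarith
  have h1 : (x - x ^ 3 / 6) ^ 2 ≤ Real.sin x ^ 2 := pow_le_pow_left₀ hnn hs.le 2
  calc 2 * x ^ 2 * (1 - x ^ 2 / 6) ^ 2 = 2 * (x - x ^ 3 / 6) ^ 2 := by ring
    _ ≤ 2 * Real.sin x ^ 2 := by linarith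

/-! ## Harmonic numbers from below -/

omit [NeZero L] in
/-- `H_2 = 3/2`. [folklore] -/
theorem harmonic_two : harmonic 2 = 3 / 2 := by
  rw [show (2 : ℕ) = 1 + 1 from rfl, harmonic_succ, show (1 : ℕ) = 0 + 1 from rfl, harmonic_succ, harmonic_zero]
  norm_num

omit [NeZero L] in
/-- `H_{(L−1)/2} ≥ 3/2` for `L ≥ 5`. [folklore] -/
theorem harmonic_half_ge (hL : 5 ≤ L) : (3 / 2 : ℝ) ≤ (harmonic ((L - 1) / 2) : ℝ) := by
  have h := Literature.NumberTheory.LFunctions.LagariasNumerical.harmonic_mono (show 2 ≤ (L - 1) / 2 by omega)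
  rw [harmonic_two] at h
  have h' : ((3 / 2 : ℚ) : ℝ) ≤ ((harmonic ((L - 1) / 2) : ℚ) : ℝ) := by exact_mod_cast h
  push_cast at h'
  exact h'

/-! ## `2λ₂ < ε₁` for every `L ≥ 5` -/

/-- ★★ **`2λ₂ < ε₁`** for the ground two-magnon profile, every `L ≥ 5`, `0 ≤ Δ`
(`λ₂ ≤ π²/(V H_N) ≤ 2π²/(3V)` against `ε₁ ≥ 2(π²/V)(1 − π²/(6V))² ≥ 1.74 π²/V`). [folklore] -/
theorem two_lam2_lt_eps1 (hL : 5 ≤ L) {Δ lam2 : ℝ} (hΔ : 0 ≤ Δ) {f : Tor L → ℝ} (hf : IsGroundTwoMagnon L Δ lam2 f) :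
    2 * lam2 < eps1 L := by
  have hLpos : (0 : ℝ) < L := by exact_mod_cast (show 0 < L by omega)
  have hL5 : (5 : ℝ) ≤ L := by exact_mod_cast hL
  have hV : (25 : ℝ) ≤ (L : ℝ) ^ 2 := by nlinarith
  have hVpos : (0 : ℝ) < (L : ℝ) ^ 2 := by positivity
  have h1 := lam2_le_harmonic L (by omega) hΔ hf
  have hH := harmonic_half_ge L hL
  have h2 := eps1_ge_cubic L (by omega)
  have hpi1 := Real.pi_gt_d2
  have hpi2 := Real.pi_lt_d2
  -- λ₂·V ≤ π²/H ≤ 2π²/3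
  have hlamV : lam2 * (L : ℝ) ^ 2 ≤ 2 * Real.pi ^ 2 / 3 := by
    have hHpos : (0 : ℝ) < (harmonic ((L - 1) / 2) : ℝ) := by linarith
    rw [le_div_iff₀ (by positivity)] at h1
    have : lam2 * ((L : ℝ) ^ 2 * (harmonic ((L - 1) / 2) : ℝ)) ≥ lam2 * ((L : ℝ) ^ 2 * (3 / 2)) ∨ lam2 < 0 := by
      by_cases hl : 0 ≤ lam2
      · left; exact mul_le_mul_of_nonneg_left (mul_le_mul_of_nonneg_left hH hVpos.le) hl
      · right; exact lt_of_not_ge hl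
    rcases this with h | h
    · nlinarith
    · have : lam2 * (L : ℝ) ^ 2 ≤ 0 := by nlinarith
      nlinarith
  -- ε₁·V ≥ 2π²(1 − π²/(6V))² ≥ 2π²·(1 − π²/150)²
  have hy : (Real.pi / L) ^ 2 = Real.pi ^ 2 / (L : ℝ) ^ 2 := by rw [div_pow]
  rw [hy] at h2
  set u : ℝ := Real.pi ^ 2 / (L : ℝ) ^ 2 with hu
  have hu0 : 0 ≤ u := by positivity
  have hu1 : u ≤ 10 / 25 := by
    rw [hu, div_le_div_iff₀ hVpos (by norm_num)]
    nlinarith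
  have hfac : (1 - u / 6) ^ 2 ≥ 13 / 15 := by nlinarith
  have hε : eps1 L * (L : ℝ) ^ 2 ≥ 2 * Real.pi ^ 2 * (13 / 15) := by
    have e : 2 * u * (1 - u / 6) ^ 2 * (L : ℝ) ^ 2 = 2 * Real.pi ^ 2 * (1 - u / 6) ^ 2 := by
      rw [hu]; field_simp
    have h3 : 2 * u * (1 - u / 6) ^ 2 * (L : ℝ) ^ 2 ≤ eps1 L * (L : ℝ) ^ 2 :=
      mul_le_mul_of_nonneg_right h2 hVpos.le
    rw [e] at h3
    nlinarith
  -- compare: 2·(2π²/3) = 4π²/3 < 26π²/15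
  by_contra hc
  have hc' : eps1 L ≤ 2 * lam2 := le_of_not_gt hc
  have : eps1 L * (L : ℝ) ^ 2 ≤ 2 * (lam2 * (L : ℝ) ^ 2) := by nlinarith
  nlinarith

/-- ★ `λ₂ < 2ε₁` for the ground profile (`L ≥ 5`, `0 ≤ Δ`): the smallness hypothesis of `GreenZeroIdentity` and of the
kernel identities, discharged ∀L. [folklore] -/
theorem lam2_lt_two_eps1 (hL : 5 ≤ L) {Δ lam2 : ℝ} (hΔ : 0 ≤ Δ) {f : Tor L → ℝ} (hf : IsGroundTwoMagnon L Δ lam2 f) :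
    lam2 < 2 * eps1 L := by
  have h := two_lam2_lt_eps1 L hL hΔ hf
  have hε : 0 < eps1 L := RateLemma.eps1_pos_of_two_le L (by omega)
  by_cases hl : 0 ≤ lam2
  · linarith
  · linarith [lt_of_not_ge hl]

/-! ## The exact `η_eff` identity -/

/-- `G̃_λ(0)` is the Green-zero sum `(1/V)Σ_{k≠0} 1/(2ε(k) − λ)`. [folklore] -/
theorem Gres_zero_zero_eq_sum_erase (lam2 : ℝ) :
    Gres L lam2 0 = (∑ k ∈ (Finset.univ : Finset (Tor L)).erase 0, 1 / (2 * epsT L k - lam2)) / (L : ℝ) ^ 2 := by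
  rw [Gres_zero_eq]
  congr 1
  rw [← Finset.add_sum_erase Finset.univ _ (Finset.mem_univ (0 : Tor L))]
  have h0 : gres L lam2 0 = 0 := by unfold gres; simp
  rw [h0, zero_add]
  refine Finset.sum_congr rfl fun k hk => ?_
  have hk0 : k ≠ 0 := Finset.ne_of_mem_erase hk
  unfold gres; rw [if_neg hk0]

/-- `λ ↦ G̃_λ(0)` is non-decreasing on `(−∞, 2ε₁)` (termwise), `L ≥ 2`. [folklore] -/
theorem Gres_zero_zero_mono (hL : 2 ≤ L) {lam lam' : ℝ} (hle : lam ≤ lam') (hlt : lam' < 2 * eps1 L) :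
    Gres L lam 0 ≤ Gres L lam' 0 := by
  rw [Gres_zero_eq, Gres_zero_eq]
  have hV : (0 : ℝ) < (L : ℝ) ^ 2 := by
    have : (0 : ℝ) < L := by exact_mod_cast (show 0 < L by omega)
    positivity
  apply div_le_div_of_nonneg_right _ hV.le
  refine Finset.sum_le_sum fun k _ => ?_
  unfold gres
  by_cases hk : k = 0
  · rw [if_pos hk, if_pos hk]
  · rw [if_neg hk, if_neg hk]
    have hε := eps1_le_epsT L hL hk
    have ha : 0 < 2 * epsT L k - lam' := by linarith
    exact one_div_le_one_div_of_le ha (by linarith)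

/-- ★★ **the exact `η_eff` identity** `1/η_eff = 4·G̃_{λ₂}(0) + 4Δ/(4(1−Δ) + Δλ₂)` for the ground profile
(`L ≥ 5`, `0 ≤ Δ < 1`; `GreenZeroIdentity` with its smallness hypothesis discharged by `lam2_lt_two_eps1`). [folklore] -/
theorem inv_etaEff_eq (hL : 5 ≤ L) {Δ lam2 : ℝ} (hΔ0 : 0 ≤ Δ) (hΔ1 : Δ < 1) {f : Tor L → ℝ}
    (hf : IsGroundTwoMagnon L Δ lam2 f) :
    1 / etaEff L lam2 = 4 * Gres L lam2 0 + 4 * Δ / (4 * (1 - Δ) + Δ * lam2) := by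
  have hpos := lam2_pos L (by omega) hΔ1 hf.1
  have hlt := lam2_lt_two_eps1 L hL hΔ0 hf
  have hG := greenZeroIdentity_holds L (by omega) Δ lam2 f hf.1 hpos hlt
  rw [← Gres_zero_zero_eq_sum_erase] at hG
  have hV : (0 : ℝ) < (L : ℝ) ^ 2 := by
    have : (0 : ℝ) < L := by exact_mod_cast (show 0 < L by omega)
    positivity
  unfold etaEff
  rw [hG]
  field_simp
  ring

/-- ★ the `Δ`-improved a-priori bound: `η_eff ≤ 1/(4G̃₀(0) + 4Δ/(4(1−Δ) + Δλ₂))` (`L ≥ 5`, `0 ≤ Δ < 1`). [folklore] -/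
theorem etaEff_le_sharp (hL : 5 ≤ L) {Δ lam2 : ℝ} (hΔ0 : 0 ≤ Δ) (hΔ1 : Δ < 1) {f : Tor L → ℝ}
    (hf : IsGroundTwoMagnon L Δ lam2 f) :
    etaEff L lam2 ≤ 1 / (4 * Gres L 0 0 + 4 * Δ / (4 * (1 - Δ) + Δ * lam2)) := by
  have hpos := lam2_pos L (by omega) hΔ1 hf.1
  have hlt := lam2_lt_two_eps1 L hL hΔ0 hf
  have hid := inv_etaEff_eq L hL hΔ0 hΔ1 hf
  have hmono := Gres_zero_zero_mono L (by omega) hpos.le hlt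
  have hG0 := Gres_zero_zero_pos L (by omega)
  have hη : 0 < etaEff L lam2 := by
    unfold etaEff
    have : (0 : ℝ) < L := by exact_mod_cast (show 0 < L by omega)
    positivity
  have hden : 0 < 4 * (1 - Δ) + Δ * lam2 := by nlinarith
  have hD : 0 ≤ 4 * Δ / (4 * (1 - Δ) + Δ * lam2) := by positivity
  have hX : 0 < 4 * Gres L 0 0 + 4 * Δ / (4 * (1 - Δ) + Δ * lam2) := by linarith
  rw [le_div_iff₀ hX]
  have : etaEff L lam2 * (4 * Gres L lam2 0 + 4 * Δ / (4 * (1 - Δ) + Δ * lam2)) = 1 := by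
    rw [← hid]; field_simp
  nlinarith

end Summit.HubbardSuperconductivity.HubbardSuperconductivity.Theorems.AnisotropyChord.Transfer.Fibre3

end
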